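import Literature.AnabelianGeometry.SemiGraphs.PSCProLCuspidalProofs
import Mathlib.Topology.Algebra.ClopenNhdofOne
import HarnessLib

/-!
# [CombGC] Theorem 1.6 (i) for general `Σ`, part 3: the common prime of `Σ_G`, `Σ_H` is automatic

Mochizuki, *A combinatorial version of the Grothendieck conjecture*, Tohoku Math. J. **59** (2007)
[CombGC], Theorem 1.6 (i), author's ms p. 13: for `G`, `H` semi-graphs of anabelioids of pro-`Σ`
PSC-type and `α : Π_G ⥲ Π_H` an isomorphism of profinite groups, "`α` is numerically cuspidal if and
only if it is group-theoretically cuspidal"; proof, p. 13 l.−5…−4: "we may assume `Σ = {l}`" (pass to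
the maximal pro-`l` quotients of the finite étale coverings).

The cell's kernel of Theorem 1.6 (i) for general `Σ` (abc-iut sub-DAG `plan/L3/SUBDAG-CombGC-Thm16.md`,
row T16-L04; `PSCProLShadowProofs.lean`, `PSCProLCuspidalProofs.lean`) runs the printed argument on the
maximal pro-`l` quotients for a prime `l` lying in BOTH `Σ_G` and `Σ_H`, and its typed form
`numericallyCuspidalIff_holds_of_common_prime` DISPLAYS that common prime as a hypothesis
(`l ∈ G.Sigma`, `l ∈ H.Sigma`).  In print the hypothesis is invisible because `Σ` is ONE set for both
`G` and `H`; over the interface `PSCDatum` ([CombGC] Def. 1.1 (ii), abc-iut-L3-t4), where each datum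
carries its own `Σ`, it is nevertheless AUTOMATIC, and this proof-only file removes it:

* `prime_mem_sigma_of_dvd_index` — the interface field `PSCDatum.proSigma` ("`Π_G` is the maximal
  pro-`Σ` quotient", Def. 1.1 (ii)) read on an open normal subgroup of finite index: every prime
  dividing `[Π_G : U]` lies in `Σ_G`;
* `exists_mem_sigma_inter_of_continuousMulEquiv` — for `Π_G` profinite and NONTRIVIAL and any
  `α : Π_G ≃ₜ* Π_H`, some prime lies in `Σ_G ∩ Σ_H`: a proper open normal subgroup `U ⊆ Π_G` exists
  (open normal subgroups form a basis of neighbourhoods of `1`), `[Π_G : U] > 1` has a prime factor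
  `p ∈ Σ_G`, and `[Π_H : α(U)] = [Π_G : U]` puts `p ∈ Σ_H`;
* `isGroupTheoreticallyCuspidal_of_isNumericallyCuspidal_of_subsingleton` — the degenerate datum on
  the TRIVIAL group (admitted by the interface, not by print): every subgroup is `⊥`, and numerical
  cuspidality at the trivial covering (`r(G) = r(H)`) already gives the cusp correspondence;
* `isGroupTheoreticallyCuspidal_of_isNumericallyCuspidal_holds'` and
  **`numericallyCuspidalIff_holds_of_inputs`** — [CombGC] Theorem 1.6 (i) AS TYPED
  (`NumericallyCuspidalIffHolds Ω`, abc-iut-L3-t4's `PSCGraphicity.lean`) for ALL data of `Ω`-type on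
  profinite groups and EVERY `Σ`, from the named origin statements only: Prop. 1.2 (i)(ii)
  (`OpenInterDeterminesComponentHolds`, `CommensurableTerminalityHolds` — both derived in the tree from
  `SeparatingCoveringsHolds`, `PSCSeparatingCoveringsProofs2.lean`), [IUTchI] Rmk. 1.2.3 (iv)
  (`CuspidalEdgeLikeCharacterizationHolds`), and the closure of `Ω`-data under finite étale coverings
  (`RestrictBDOfPSCTypeHolds`) and maximal pro-`l` quotients (`MapAlongProLOfPSCTypeHolds`); no displayed
  hypothesis remains.

Proof-only (0 defs); plain profinite group theory over the interface; a FACT row is an assumption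
label — nothing here asserts the printed claims for curves, and nothing here takes a side on
[IUTchIII] Cor. 3.12. [cite: MochizukiCombGC2007, Thm 1.6(i) p.13] [cite: MochizukiCombGC2007, Def 1.1(ii) p.6]
-/

noncomputable section

namespace Literature.AnabelianGeometry.SemiGraphs

namespace PSCDatum

open scoped Pointwise

universe u

variable {P : Type u} [Group P] [TopologicalSpace P] [IsTopologicalGroup P]
variable {P' : Type u} [Group P'] [TopologicalSpace P'] [IsTopologicalGroup P']

/-! ### `Σ_G` contains every prime realised by a finite quotient of `Π_G` -/

section Sigma

omit [IsTopologicalGroup P] in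
/-- **[CombGC] Def. 1.1 (ii), "`Π_G` … the maximal pro-`Σ` quotient"**, read on the interface field
`PSCDatum.proSigma`: every prime dividing the index of an open normal subgroup of finite index of
`Π_G` lies in `Σ_G`. [cite: MochizukiCombGC2007, Def 1.1(ii) p.6] -/
theorem prime_mem_sigma_of_dvd_index (G : PSCDatum P) {U : Subgroup P} [hUn : U.Normal]
    [U.FiniteIndex] (hUo : IsOpen (U : Set P)) {p : ℕ} (hp : p.Prime) (hdvd : p ∣ U.index) :
    p ∈ G.Sigma :=
  G.proSigma.prime_mem { toSubgroup := U, isOpen' := hUo, isNormal' := hUn }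
    (show Finite (P ⧸ U) from inferInstance) p hp hdvd

omit [IsTopologicalGroup P'] in
/-- **The common prime is automatic.**  For `Π_G` profinite and nontrivial and ANY isomorphism of
topological groups `α : Π_G ≅ Π_H` to the PSC-fundamental group of another datum `H`, some prime lies
in `Σ_G ∩ Σ_H`: a proper open normal subgroup `U ⊆ Π_G` has index `> 1`, whose prime factors lie in
`Σ_G` (`Π_G` pro-`Σ_G`) and — the index of `α(U) ⊆ Π_H` being the same — in `Σ_H` (`Π_H` pro-`Σ_H`).
(In print `Σ_G = Σ_H = Σ` by convention, [CombGC] Thm. 1.6, p. 13.)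
[cite: MochizukiCombGC2007, Thm 1.6 p.13] [cite: MochizukiCombGC2007, Def 1.1(ii) p.6] -/
theorem exists_mem_sigma_inter_of_continuousMulEquiv [CompactSpace P] [TotallyDisconnectedSpace P]
    [Nontrivial P] (G : PSCDatum P) (H : PSCDatum P') (α : P ≃ₜ* P') :
    ∃ l : ℕ, l ∈ G.Sigma ∧ l ∈ H.Sigma := by
  -- a proper open normal subgroup of `Π_G`
  obtain ⟨x, hx⟩ := exists_ne (1 : P)
  obtain ⟨U, hU⟩ := ProfiniteGrp.exist_openNormalSubgroup_sub_open_nhds_of_one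
    (isOpen_compl_singleton (x := x)) (Set.mem_compl_singleton_iff.mpr hx.symm)
  have hUne : (U : Subgroup P) ≠ ⊤ := by
    intro h
    have hxU : x ∈ ((U : Subgroup P) : Set P) := by rw [h]; exact Subgroup.mem_top x
    exact (Set.mem_compl_singleton_iff.mp (hU hxU)) rfl
  haveI : (U : Subgroup P).FiniteIndex := finiteIndex_of_isOpen (U : Subgroup P) U.isOpen
  obtain ⟨p, hp, hdvd⟩ :=
    Nat.exists_prime_and_dvd (Subgroup.one_lt_index_of_ne_top hUne).ne'
  refine ⟨p, G.prime_mem_sigma_of_dvd_index U.isOpen hp hdvd, ?_⟩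
  -- transport `U` along `α`
  set f := α.toMulEquiv.toMonoidHom with hf
  haveI : ((U : Subgroup P).map f).Normal := U.isNormal'.map f α.surjective
  have hidx : ((U : Subgroup P).map f).index = (U : Subgroup P).index :=
    Subgroup.index_map_of_bijective (f := f) ⟨α.injective, α.surjective⟩ _
  haveI : ((U : Subgroup P).map f).FiniteIndex :=
    ⟨by rw [hidx]; exact Subgroup.FiniteIndex.index_ne_zero⟩
  exact H.prime_mem_sigma_of_dvd_index (isOpen_map α _ U.isOpen) hp (hidx ▸ hdvd)

end Sigma

/-! ### The degenerate datum on the trivial group -/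

section Trivial

omit [IsTopologicalGroup P] [IsTopologicalGroup P'] in
/-- On the TRIVIAL group (a degenerate datum the interface admits) numerical cuspidality already
gives the cusp correspondence: every subgroup of `Π_G`, `Π_H` is `⊥`, and `r(G) = r(H)` (numerical
cuspidality at the trivial covering) says that `G` has a cusp iff `H` does.
[cite: MochizukiCombGC2007, Thm 1.6(i) p.13] -/
theorem isGroupTheoreticallyCuspidal_of_isNumericallyCuspidal_of_subsingleton [Subsingleton P]
    (G : PSCDatum P) (H : PSCDatum P') (α : P ≃ₜ* P') (hnum : G.IsNumericallyCuspidal H α) :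
    G.IsGroupTheoreticallyCuspidal H α := by
  haveI : Subsingleton P' := α.symm.injective.subsingleton
  have hr : Fintype.card G.graph.C = Fintype.card H.graph.C := by
    have h1 := hnum ⊤ (by rw [Subgroup.coe_top]; exact isOpen_univ)
    rwa [Subgroup.map_top_of_surjective _ α.surjective, cuspCount_top, cuspCount_top] at h1
  refine ⟨fun A hA => ?_, fun B hB => ?_⟩
  · obtain ⟨c, -, -⟩ := hA
    obtain ⟨c'⟩ : Nonempty H.graph.C :=
      Fintype.card_pos_iff.mp (hr ▸ Fintype.card_pos_iff.mpr ⟨c⟩)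
    exact ⟨c', 1, Subsingleton.elim _ _⟩
  · obtain ⟨c', -, -⟩ := hB
    obtain ⟨c⟩ : Nonempty G.graph.C :=
      Fintype.card_pos_iff.mp (hr.symm ▸ Fintype.card_pos_iff.mpr ⟨c'⟩)
    exact ⟨G.cuspGp c, ⟨c, 1, (one_smul _ _).symm⟩, Subsingleton.elim _ _⟩

end Trivial

/-! ### [CombGC] Theorem 1.6 (i) over the origin, every `Σ`, no displayed hypothesis -/

section Origin

variable (Ω : PSCOrigin.{u})

/-- **[CombGC] Theorem 1.6 (i), necessity, over the origin `Ω` for EVERY `Σ`** — the successor of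
`isGroupTheoreticallyCuspidal_of_isNumericallyCuspidal_holds` WITHOUT its displayed common prime:
granting, for all data of `Ω`-type, profiniteness of the PSC-fundamental groups (displayed inline),
Prop. 1.2 (i)(ii) (`OpenInterDeterminesComponentHolds`, `CommensurableTerminalityHolds`), [IUTchI]
Rmk. 1.2.3 (iv) (`CuspidalEdgeLikeCharacterizationHolds`), and the closure of `Ω`-data under finite
étale coverings (`RestrictBDOfPSCTypeHolds`) and maximal pro-`l` quotients (`MapAlongProLOfPSCTypeHolds`):
for `G`, `H` of `Ω`-type, every numerically cuspidal `α : Π_G ≅ Π_H` is group-theoretically cuspidal.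
(Nontrivial `Π_G`: the common prime of `exists_mem_sigma_inter_of_continuousMulEquiv` feeds the
pro-`l` route of `PSCProLCuspidalProofs.lean`; trivial `Π_G`: the degenerate case above.)
[cite: MochizukiCombGC2007, Thm 1.6(i) p.13] -/
theorem isGroupTheoreticallyCuspidal_of_isNumericallyCuspidal_holds'
    (hprof : ∀ ⦃Q : Type u⦄ [Group Q] [TopologicalSpace Q] [IsTopologicalGroup Q] (G : PSCDatum Q),
      Ω.IsOfPSCType G → CompactSpace Q ∧ TotallyDisconnectedSpace Q)
    (hct : CommensurableTerminalityHolds Ω) (h12 : OpenInterDeterminesComponentHolds Ω)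
    (hch : CuspidalEdgeLikeCharacterizationHolds Ω) (hres : RestrictBDOfPSCTypeHolds Ω)
    (hmap : MapAlongProLOfPSCTypeHolds Ω)
    ⦃P : Type u⦄ [Group P] [TopologicalSpace P] [IsTopologicalGroup P]
    ⦃P' : Type u⦄ [Group P'] [TopologicalSpace P'] [IsTopologicalGroup P']
    {G : PSCDatum P} {H : PSCDatum P'} {α : P ≃ₜ* P'} (hGΩ : Ω.IsOfPSCType G) (hHΩ : Ω.IsOfPSCType H)
    (hnum : G.IsNumericallyCuspidal H α) : G.IsGroupTheoreticallyCuspidal H α := by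
  obtain ⟨hcP, htP⟩ := hprof G hGΩ
  rcases subsingleton_or_nontrivial P with hP | hP
  · exact isGroupTheoreticallyCuspidal_of_isNumericallyCuspidal_of_subsingleton G H α hnum
  · obtain ⟨l, hl, hl'⟩ := G.exists_mem_sigma_inter_of_continuousMulEquiv H α
    exact isGroupTheoreticallyCuspidal_of_isNumericallyCuspidal_holds Ω hprof hct h12 hch hres hmap
      hGΩ hHΩ hl hl' hnum

/-- **[CombGC] Theorem 1.6 (i) AS TYPED, for every `Σ`, from named origin statements only**
("`α` is numerically cuspidal if and only if it is group-theoretically cuspidal", p. 13): the typed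
statement `NumericallyCuspidalIffHolds Ω` of abc-iut-L3-t4's `PSCGraphicity.lean` for all data of
`Ω`-type on profinite groups, from Prop. 1.2 (i)(ii), [IUTchI] Rmk. 1.2.3 (iv) (cuspidal part), and the
closure of `Ω`-data under finite étale coverings and maximal pro-`l` quotients — the successor of
`numericallyCuspidalIff_holds_of_common_prime` with NO displayed hypothesis (the common prime of
`Σ_G`, `Σ_H` is derived, `exists_mem_sigma_inter_of_continuousMulEquiv`).  Necessity: this file;
sufficiency: Prop. 1.2 (i) alone (abc-iut-w4-d052's `numericallyCuspidal_of_groupTheoreticallyCuspidal_holds`).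
[cite: MochizukiCombGC2007, Thm 1.6(i) p.13] -/
theorem numericallyCuspidalIff_holds_of_inputs
    (hprof : ∀ ⦃Q : Type u⦄ [Group Q] [TopologicalSpace Q] [IsTopologicalGroup Q] (G : PSCDatum Q),
      Ω.IsOfPSCType G → CompactSpace Q ∧ TotallyDisconnectedSpace Q)
    (hct : CommensurableTerminalityHolds Ω) (h12 : OpenInterDeterminesComponentHolds Ω)
    (hch : CuspidalEdgeLikeCharacterizationHolds Ω) (hres : RestrictBDOfPSCTypeHolds Ω)
    (hmap : MapAlongProLOfPSCTypeHolds Ω) :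
    Literature.AnabelianGeometry.SemiGraphs.PSCDatum.NumericallyCuspidalIffHolds Ω := by
  intro Q _ _ _ Q' _ _ _ G H α hGΩ hHΩ
  exact ⟨isGroupTheoreticallyCuspidal_of_isNumericallyCuspidal_holds' Ω hprof hct h12 hch hres hmap
      hGΩ hHΩ,
    numericallyCuspidal_of_groupTheoreticallyCuspidal_holds Ω h12 G H α hGΩ hHΩ⟩

end Origin

end PSCDatum

end Literature.AnabelianGeometry.SemiGraphs

end
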